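import Summits.BirchSwinnertonDyer.BirchSwinnertonDyer.Theses.PrintX10b
import Literature.NumberTheory.EllipticCurves.AnalyticRankModularityProofs
import Literature.NumberTheory.EllipticCurves.HeegnerPointsOfConductorOneGaloisConjProofs
import Literature.NumberTheory.EllipticCurves.HeegnerPointsOfConductorOneRationalityProofs
import Literature.NumberTheory.EllipticCurves.MatarNekovar2019.IrreducibleOverQuadraticFieldProofs
import Literature.NumberTheory.EllipticCurves.NeronIsogenyScalingHoldsProofs
import HarnessLib

/-!
# Route `PrintX10b`, support item `HeegnerPrintFactsX10b` (stmt-BirchSwinnertonDyer-21206): the SLIMMED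
# dependency list — the fifteen-conjunct Heegner/CM print pack from TEN irredundant inputs

D-0154 (2) INPUTS→UNCONDITIONAL, `INPUTS-LIST-2.md` §4 T1 «PackSlim» (cell `pub/bsd-wall`, seat
`bsd-inputs-pack-p1`). `HeegnerPrintFactsX10b` is the conjunction, in the road-B kernel's binder order,
of: Gross–Zagier and Kolyvagin over `K` (∀-schemas); Galois descent of the conductor-`1` Heegner point;
Shimura reciprocity `φ(τ) ∈ E(H_K)`; Cha 2005 Rmk 25; Matar–Nekovář 2019 Prop 5.26 (2); Yan–Zhu 2026
Thm 5.7 (1) ∘ BCS Prop 4.2.2 ∘ CGLS 5.1.3; JSW 2017 Thm 3.3.1; entireness of `L(E,s)`; newform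
existence; Hoffstein–Luo 1997; Néron-scaling integrality; Burungale–Flach / Rubin CM rank-0 triple;
Li–Liu–Tian 2024 Thm 1.1; Kobayashi 2013 Cor 1.4. FIVE of the fifteen are THEOREMS of the tree:

* conjunct 3: `heegnerPointOfConductor_one_galoisConj_holds` (`HeegnerPointsOfConductorOneGaloisConjProofs.lean`);
* conjunct 4: `phi_heegnerTau_mem_singularModuliField_holds` (`HeegnerPointsOfConductorOneRationalityProofs.lean`);
* conjunct 6 (the route's CLOSED item 21208): `MatarNekovar2019.prop526_hasIrreducibleModPGaloisRep_baseChange_holds`;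
* conjunct 9 (`EntireLFunctionRat`, 19273) from conjunct 10 (`NewformExistence`, 19382):
  `WeierstrassCurve.hasEntireLFunction_rat_of_exists_isNewformOf` (`AnalyticRankModularityProofs.lean`);
* conjunct 12 (the route's CLOSED item 21209): `integral_neronScaling_of_isGloballyMinimal_holds`
  (`NeronIsogenyScalingHoldsProofs.lean`).

Theorem `heegnerPrintFactsX10b_of_slim`: the pack from TEN inputs — Gross–Zagier, Kolyvagin (verbatim
∀-schemas) and the route items `ChaStructureUpperHalf` (19934),
`YZAnticyclotomicGeneratorConstantCoeffThree` (21210), `JSWAnticyclotomicControl` (20535),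
`NewformExistence` (19382), `HoffsteinLuoTwistNonvanishing` (19372), `CMRankZeroBSDTriple` (19423),
`LiLiuTianCMRankOne` (19569), `KobayashiCMRankOne` (19570); plus the in-route edge
`printX10b_entireLFunctionRat_of_newformExistence`. HONEST FRAMING: pure glue over landed theorems; no
cite-only fact is proved here; the ten remaining inputs (Gross–Zagier–Kolyvagin among them) stay print
hypotheses and the route stays conditional on them AS TYPED. Nothing here proves BSD; BSD is not proved
by any of this.
-/

set_option autoImplicit false
set_option linter.dupNamespace false

namespace Summit.BirchSwinnertonDyer.BirchSwinnertonDyer.Theorems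

open Literature.NumberTheory.EllipticCurves
open Summit.BirchSwinnertonDyer.BirchSwinnertonDyer.Theses.PrintX10b

/-- In-route edge: the newform item `NewformExistence` (19382) gives `EntireLFunctionRat` (19273), by
`WeierstrassCurve.hasEntireLFunction_rat_of_exists_isNewformOf` (Diamond–Shurman Thm 8.8.3 ⇒
Thm 5.10.2). [folklore] -/
theorem printX10b_entireLFunctionRat_of_newformExistence (hnf : NewformExistence) :
    Summit.BirchSwinnertonDyer.BirchSwinnertonDyer.Theses.PrintX10b.EntireLFunctionRat :=
  WeierstrassCurve.hasEntireLFunction_rat_of_exists_isNewformOf hnf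

/-- **`HeegnerPrintFactsX10b` from ten irredundant inputs** (route `PrintX10b`, item
stmt-BirchSwinnertonDyer-21206; INPUTS-LIST-2 T1): Gross–Zagier and Kolyvagin over `K` (conjuncts 1–2,
verbatim), `ChaStructureUpperHalf`, `YZAnticyclotomicGeneratorConstantCoeffThree`,
`JSWAnticyclotomicControl`, `NewformExistence`, `HoffsteinLuoTwistNonvanishing`, `CMRankZeroBSDTriple`,
`LiLiuTianCMRankOne`, `KobayashiCMRankOne` imply the fifteen-conjunct pack: conjuncts 3, 4, 6, 9, 12
are the tree theorems `heegnerPointOfConductor_one_galoisConj_holds`,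
`phi_heegnerTau_mem_singularModuliField_holds`,
`MatarNekovar2019.prop526_hasIrreducibleModPGaloisRep_baseChange_holds`,
`WeierstrassCurve.hasEntireLFunction_rat_of_exists_isNewformOf`,
`integral_neronScaling_of_isGloballyMinimal_holds`. Pure glue; the ten hypotheses remain print inputs.
[folklore] -/
theorem heegnerPrintFactsX10b_of_slim
    (hGZ : ∀ (N : ℕ) [NeZero N] (W : WeierstrassCurve ℚ) (K : Type) [Field K] [NumberField K],
      gross_zagier N W K)
    (hKo : ∀ (N : ℕ) [NeZero N] (W : WeierstrassCurve ℚ) (K : Type) [Field K] [NumberField K],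
      kolyvagin N W K)
    (hChaU : ChaStructureUpperHalf) (h57 : YZAnticyclotomicGeneratorConstantCoeffThree)
    (h331 : JSWAnticyclotomicControl) (hnf : NewformExistence) (hHL : HoffsteinLuoTwistNonvanishing)
    (hCM : CMRankZeroBSDTriple) (hLLT : LiLiuTianCMRankOne) (hKob : KobayashiCMRankOne) :
    Summit.BirchSwinnertonDyer.BirchSwinnertonDyer.Theses.PrintX10b.HeegnerPrintFactsX10b :=
  ⟨hGZ, hKo,
    fun N _ W K _ _ => heegnerPointOfConductor_one_galoisConj_holds N W K,
    fun N _ W K _ _ => phi_heegnerTau_mem_singularModuliField_holds N W K,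
    hChaU, MatarNekovar2019.prop526_hasIrreducibleModPGaloisRep_baseChange_holds, h57, h331,
    printX10b_entireLFunctionRat_of_newformExistence hnf, hnf, hHL,
    integral_neronScaling_of_isGloballyMinimal_holds, hCM, hLLT, hKob⟩

end Summit.BirchSwinnertonDyer.BirchSwinnertonDyer.Theorems
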